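import Summits.HodgeConjecture.HodgeConjecture.Theorems.VHCAbelianSchemesRoadLocallyServedAnchor
import Summits.HodgeConjecture.HodgeConjecture.Theorems.VHCAbelianSchemesRoadSecantQuotientAnchorPinnedDefs
import Summits.HodgeConjecture.HodgeConjecture.Theorems.VHCAbelianSchemesRoadTwistedDoorPrimeIsoRespects
import Summits.HodgeConjecture.HodgeConjecture.Theorems.VHCAbelianSchemesRoadLocallyServedAnchorCarriedPair
import Summits.HodgeConjecture.HodgeConjecture.Theorems.VHCAbelianSchemesRoadSecantQuotientOffHyperellipticOfPrintForall
import Literature.AlgebraicGeometry.HodgeTheory.SecantQuotientJacobianTwistedCarrierForall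
import Summits.HodgeConjecture.HodgeConjecture.Theorems.VHCAbelianSchemesRoadSecondCarriedHGoodTypingDefs
import Summits.HodgeConjecture.HodgeConjecture.Theorems.VHCAbelianSchemesRoadSecantQuotientHasMover
import Summits.HodgeConjecture.HodgeConjecture.Theorems.VHCAbelianSchemesRoadSecondCarriedOfNodes
import Summits.HodgeConjecture.HodgeConjecture.Theorems.VHCAbelianSchemesRoadSecondCarriedOfTGRR
import Summits.HodgeConjecture.HodgeConjecture.Theorems.VHCAbelianSchemesRoadIsogenyPushforwardChernCharacterHolds
import Summits.HodgeConjecture.HodgeConjecture.Theorems.VHCAbelianSchemesRoadPrintSheafHandleDefs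
import Summits.HodgeConjecture.HodgeConjecture.Theorems.VHCAbelianSchemesRoadOffDiagonalSomeMoverOfPrintSheafHandle
import Summits.HodgeConjecture.HodgeConjecture.Theorems.VHCAbelianSchemesRoadSecantQuotientPinnedRigidityOfEndInt
import Literature.AlgebraicGeometry.Motives.AbelianVarietyManinMumfordRaynaud
import HarnessLib

/-!
# Road №4 (`VHCAbelianSchemesRoad`), crux stmt-HodgeConjecture-26512 `DiagLocalOfMarkmanPinnedForall` — THE MOVER-TRAP VOCABULARY of the
# lens line «negation» (`Cruxes/DiagLocalOfMarkmanPinnedForall/Lines/MoverTrap.lean` fdaab6dae2d2c84a, §0–§1 + its sorry-free compositions),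
# as an IMPORTABLE Theorems-lane module (no stubs, no `sorry`)

research route conditional on HC_CM; not a corollary; Q11.4-sentence-2 already refuted in dim ≥ 3.
NOTHING here says (c4a) `PrintSheafHandleExists`, its End-trivial re-key (c4a-E), the line's stubs S1–S4, the crux, №4, HC_AV, HC_CM or HC
holds; HC_CM HELD, by name only; typed ≠ proved; a displayed input is not progress.

WHY THIS FILE EXISTS (director-hodge g16 R16.47 (2)(a), seat core-w3 g2; idea-crit-6 g4 LENS RULING 26512-N1 «PASS-WITH-PRICE»). The lens
seat plan-lens-HodgeAV-26512-negation typed the MOVER TRAP — the obstruction shape behind «no print-sheaf handle at a datum» — together with its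
logic and four stubs in a Cruxes WORKFILE. Cruxes files carry sorries and are not importable by Theorems-lane proofs, so the kernel-class nodes
of the two lens lines ((inj) `stub_injOnMoverKernels_sndDual`, S3 `stub_KSimple_of_endTrivial`, (MM) `stub_moverFamily_of_confined`,
S2 `stub_moverConfinement_of_KSimple`) had no by-name vocabulary to be proved against. This module is that vocabulary, VERBATIM from the
workfile (names, binders and bodies byte-identical; only the namespace moves — and the section variable `D` is written as an explicit binder — from `…Cruxes.DiagLocalOfMarkmanPinnedForall.MoverTrap` to
`…Ring2.SemiregularRepresentatives.MoverTrap`):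

* §0 OBJECTS — `AdmTw'` (the crux's admissibility disjunction), `extJumpLocus A E•` = `{x ∈ A(ℂ) | ∃ k, Ext^k(τ_x^* E•, E•) ≠ 0}` with
  `offDiagonalExtVanishing_iff` ((C^∨) ⟺ the non-trivial kernel points miss the jump locus), `IsMoverTrap D S` («no finite bad set steers the
  mover family `ḡ_{u_m}` off `S`»), `IsPsiStable D f` (`φ_d`-stability of an abelian subvariety `f : B → J × Ĵ`), `KSimple D`, `EndTrivial D`
  (the route's v3.12 anchor key `End J = ℤ·𝟙`), `qImageOff D f`, and the End-trivial re-key `PrintSheafHandleExistsEnd C` of (c4a) (an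
  IN-HOUSE `@[conjecture] def`, displayed wherever used, never a Literature fact) with the monotonicity lemma
  `printSheafHandleExistsEnd_of_printSheafHandleExists`;
* §1 LOGIC (sorry-free) — `nonempty_printSheafHandle_iff_exists_untrapped` (a handle exists at `(D, θ₀)` IFF some `AdmTw′`-pinned datum of some
  pinned-served class has an UNTRAPPED Ext-jump locus), `isEmpty_printSheafHandle_iff_allTrapped` (the typed counterexample shape),
  `not_printSheafHandleExists_of_allTrapped`, `IsMoverTrap.mono`;
* §2 COMPOSITIONS (sorry-free, the line's stubs S1/S2/S3/S4 taken as HYPOTHESES by statement) — `isMoverTrap_extJumpLocus_of_psiStable_subset`,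
  `false_of_printSheafHandle_of_psiStable_subset` (negative side), `nonempty_printSheafHandle_of_KSimple_of_properJump`,
  `printSheafHandleExistsEnd_of_stubs : Raynaud1983_maninMumford → (S2) → (S3) → (S4) → ∀ C, PrintSheafHandleExistsEnd C`,
  `offDiagonalExtVanishing_someMover_End_of_printSheafHandleExistsEnd` ((c4) at End-trivial data, p646528's CRT engine verbatim);
* §3 — `secondCarried_63_offHypDisjEnd_of_hGoodEndNodesEnd`: birth.lean v3.14's 2m″ kernel composition with `hEnd` threaded into the (C^∨)-node
  (hypothesis form over tree theorems only; birth.lean is NOT imported).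

The stub-consuming declarations of the workfile (`printSheafHandleExistsEnd_of`, `anchoredSpan_63_offHypDisjEnd_of_pinnedForall_moverTrap`,
`DiagLocalOfMarkmanPinnedForall_of_moverTrap`) and the four `stub_*` are NOT here. Companion module for the «transfer» line's predicates
((MM)/(inj)): `Theorems/VHCAbelianSchemesRoadTwistConfinedMoverFamilyDefs.lean`.

References: [cite: Markman2025SecantWeil, §1.5 (p. 7), §4.1, §9.1 (Assumption 9.1.1), §9.3 Lemma 9.3.3 and Lemma 9.3.11]
[cite: Raynaud1983SousVarietes, Théorème principal (p. 327)] [cite: MumfordAV1970, §7 Thm. 4 (p. 72), §19 Thm. 1 (Poincaré reducibility)]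
[cite: Mukai1978, §3] [cite: BirkenhakeLange2004, §5.3 (norm-endomorphism ∕ abelian subvarieties and idempotents), §13.4]
-/

noncomputable section

open CategoryTheory CategoryTheory.Limits AlgebraicGeometry Topology

namespace Summit.HodgeConjecture.HodgeConjecture.Ring2.SemiregularRepresentatives

set_option linter.dupNamespace false -- the cell's namespace repeats the summit name, as in every `Ring2*` file

namespace MoverTrap

open Literature.AlgebraicGeometry Literature.AlgebraicGeometry.Motives Literature.AlgebraicGeometry.Motives.AbelianVariety
open Literature.AlgebraicGeometry.HodgeTheory Literature.AlgebraicGeometry.Markman2025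
open Literature.AlgebraicTopology.SingularHomology
open Summit.HodgeConjecture.HodgeConjecture.Ring2.AbelianAll (carriedClasses)
open Literature.Barriers.HodgeConjecture (divisorClassesSpan)

/-! ## §0 Objects -/

/-- The crux's admissibility disjunction `AdmTw′ = gluableSigmaAdmissible ∨ bfSingleAdmissible′`, abbreviated. [cite: BuchweitzFlenner2003, Def. 4.1] -/
abbrev AdmTw' : PerfectAdmissibility :=
  fun n X₀ I E => Summit.Ventures.HSemireg.gluableSigmaAdmissible n X₀ I E ∨ bfSingleAdmissible' n X₀ I E

/-- **The Ext-JUMP LOCUS of a complex `E•` on an abelian variety**: the points `x ∈ A(ℂ)` with `Ext^k(τ_x^*E•, E•) ≠ 0` for some `k`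
(same ambient derived category as `OffDiagonalExtVanishing`). [cite: Mukai1978, §3] -/
def extJumpLocus (A : AbelianVariety ℂ) (E : CochainComplex A.X.left.Modules ℤ) : Set (A.Points ℂ) :=
  {x | ∃ k : ℤ,
    letI := HasDerivedCategory.standard A.X.left.Modules
    ¬ Subsingleton (ShiftedHom (DerivedCategory.Q.obj (translationPullbackComplex A x E)) (DerivedCategory.Q.obj E) k)}

/-- (C^∨) for `(g, E•)` says exactly: the non-trivial kernel points of `g` miss the Ext-jump locus of `E•`. [cite: Mukai1978, §3] -/
theorem offDiagonalExtVanishing_iff (A : AbelianVariety ℂ) (g : A ⟶ A) (E : CochainComplex A.X.left.Modules ℤ) :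
    OffDiagonalExtVanishing A g E ↔
      ∀ x : A.Points ℂ, x ∈ Hom.kerPoints (specOver ℂ ℂ) g → x ≠ 1 → x ∉ extJumpLocus A E := by
  simp only [OffDiagonalExtVanishing, extJumpLocus, Set.mem_setOf_eq, not_exists, not_not]

section Datum

-- (binder `D` written explicitly on each declaration of this section — the elaborated declarations are those of the workfile)

/-- **A MOVER TRAP** (`IsMoverTrap D S`): a set `S ⊆ Y(ℂ)` such that for EVERY finite set `T` of orders `> 1` some mover `ḡ_{u_m}`
(`D.IsMover m g`) with `m² + d` prime to `T` has a kernel point `x ≠ 1` in `S` — i.e. no finite bad set steers the mover family off `S`.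
A predicate; nothing asserted. [cite: Markman2025SecantWeil, §1.5 (p. 7) and §9.3 Lemma 9.3.3] -/
def IsMoverTrap (D : SecantQuotientDatum) (S : Set (D.Y.Points ℂ)) : Prop :=
  ∀ T : Finset ℕ, (∀ N ∈ T, 1 < N) →
    ∃ (m : ℤ) (g : D.Y ⟶ D.Y) (x : D.Y.Points ℂ),
      D.IsMover m g ∧ (∀ N ∈ T, ¬ ((N : ℤ) ∣ m ^ 2 + (D.d : ℤ))) ∧
      x ∈ Hom.kerPoints (specOver ℂ ℂ) g ∧ x ≠ 1 ∧ x ∈ S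

/-- **`φ_d`-STABILITY of an abelian subvariety `f : B → J × Ĵ`**: `φ_d` restricts to an endomorphism of `B`. [cite: BirkenhakeLange2004, §13.4] -/
def IsPsiStable (D : SecantQuotientDatum) {B : AbelianVariety ℂ} (f : B ⟶ D.P) : Prop :=
  ∃ ψB : B ⟶ B, ψB ≫ f = f ≫ D.ψ

/-- **K-SIMPLICITY of the datum** (`K = ℚ(√−d)` acting on `J × Ĵ` through `φ_d`): `J × Ĵ` has NO `φ_d`-stable abelian subvariety of dimension
strictly between `0` and `dim (J × Ĵ) = 6` (⟺ `End⁰(J) ⊗ K` is a division algebra). A predicate. [cite: BirkenhakeLange2004, §5.3 and §13.4] -/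
def KSimple (D : SecantQuotientDatum) : Prop :=
  ∀ (B : AbelianVariety ℂ) (f : B ⟶ D.P), IsClosedImmersion (Hom.toSchemeHom f) → IsPsiStable D f →
    0 < B.dim → B.dim < D.P.dim → False

/-- **The route's v3.12 anchor key: the presenting Jacobian is End-TRIVIAL**, `End J = ℤ·𝟙`. [cite: Markman2025SecantWeil, Thm. 1.4.1 («generic»)] -/
def EndTrivial (D : SecantQuotientDatum) : Prop :=
  ∀ f : D.𝒥.J ⟶ D.𝒥.J, ∃ n : ℤ, f = n • 𝟙 D.𝒥.J

/-- The `q`-image in `Y(ℂ)` of the points of an abelian subvariety `f : B → J × Ĵ`, minus the identity. [cite: MumfordAV1970, §7 Thm. 4 (p. 72)] -/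
def qImageOff (D : SecantQuotientDatum) {B : AbelianVariety ℂ} (f : B ⟶ D.P) : Set (D.Y.Points ℂ) :=
  {y | y ≠ 1 ∧ ∃ Q : B.Points ℂ, y = AlgPoints.map D.q.hom.hom.hom (AlgPoints.map f.hom.hom.hom Q)}

end Datum

/-- **`PrintSheafHandleExistsEnd C` — (c4a) RE-KEYED to the route's End-trivial anchor family (v3.12 oHE)**: the handle exists at every
non-hyperelliptic H-good datum whose Jacobian is End-trivial. Weaker than `PrintSheafHandleExists C`; it is ALL that birth.lean's
`secondCarried_63_secantQuotientPinnedOffHypDisjEndPrime_of_hGoodEndNodes` consumes (its `hpres` carries `hEnd`). IN-HOUSE; displayed wherever used.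
[cite: Markman2025SecantWeil, §9.3 Lemma 9.3.11] -/
@[conjecture] def PrintSheafHandleExistsEnd (C : ChernCharacterBetti) : Prop :=
  ∀ (D : SecantQuotientDatum) (θ₀ : complexBetti D.𝒥.J.X 2),
    ¬ D.𝒥.IsHyperelliptic → OrbitTranslatesDisjoint D.𝒥 D.G₁ D.G₂ → D.𝒥.J.IsPolarizationClassOf D.Θ θ₀ → EndTrivial D →
    Nonempty (D.PrintSheafHandle C θ₀)

/-- (c4a) implies its End-trivial re-key (monotonicity). [cite: Markman2025SecantWeil, §9.3 Lemma 9.3.11] -/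
theorem printSheafHandleExistsEnd_of_printSheafHandleExists (C : ChernCharacterBetti) (h : PrintSheafHandleExists C) :
    PrintSheafHandleExistsEnd C :=
  fun D θ₀ hnh hH hθ₀ _ => h D θ₀ hnh hH hθ₀

/-! ## §1 Logic: the handle question IS the trap question (sorry-free) -/

section Logic

variable {C : ChernCharacterBetti} {D : SecantQuotientDatum} {θ₀ : complexBetti D.𝒥.J.X 2}

/-- A handle's carrier has an UNTRAPPED Ext-jump locus (its own bad set steers the movers off it). [cite: Markman2025SecantWeil, §9.3 Lemma 9.3.3] -/
theorem not_isMoverTrap_extJumpLocus_of_printSheafHandle (H : D.PrintSheafHandle C θ₀) :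
    ¬ IsMoverTrap D (extJumpLocus D.Y H.datum.E) := by
  intro htrap
  obtain ⟨m, g, x, hg, hcop, hx, hx1, hxS⟩ := htrap H.bad H.one_lt_of_mem_bad
  exact ((offDiagonalExtVanishing_iff D.Y g H.datum.E).1 (H.offDiag m g hg hcop) x hx hx1) hxS

/-- Conversely an `AdmTw′`-pinned datum of a pinned-served class with UNTRAPPED Ext-jump locus IS a handle (the finite set witnessing
non-trap is the bad set). [cite: Markman2025SecantWeil, §9.3 Lemma 9.3.3] -/
theorem nonempty_printSheafHandle_of_untrapped {γ : complexBetti D.Y.X (2 * 3)}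
    (hγ : γ ∈ secantQuotientServedClassesPinned D.Y.X (D.hY θ₀)) (𝓓 : PinnedTwistedDatum C AdmTw' D.Y.X (D.hY θ₀) γ)
    (h : ¬ IsMoverTrap D (extJumpLocus D.Y 𝓓.E)) : Nonempty (D.PrintSheafHandle C θ₀) := by
  simp only [IsMoverTrap, not_forall, not_exists, not_and] at h
  obtain ⟨T, hT, hgood⟩ := h
  refine ⟨{ γ := γ, served := hγ, datum := 𝓓, bad := T, one_lt_of_mem_bad := hT, offDiag := fun m g hg hcop => ?_ }⟩
  rw [offDiagonalExtVanishing_iff]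
  exact fun x hx hx1 hxS => hgood m g x hg hcop hx hx1 hxS

/-- **THE HANDLE QUESTION IS THE TRAP QUESTION**: a print-sheaf handle exists at `(D, θ₀)` iff some `AdmTw′`-pinned datum of some pinned-served
class has an Ext-jump locus which is not a mover trap. [cite: Markman2025SecantWeil, §9.3 Lemma 9.3.3] -/
theorem nonempty_printSheafHandle_iff_exists_untrapped :
    Nonempty (D.PrintSheafHandle C θ₀) ↔
      ∃ γ ∈ secantQuotientServedClassesPinned D.Y.X (D.hY θ₀), ∃ 𝓓 : PinnedTwistedDatum C AdmTw' D.Y.X (D.hY θ₀) γ,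
        ¬ IsMoverTrap D (extJumpLocus D.Y 𝓓.E) := by
  constructor
  · rintro ⟨H⟩
    exact ⟨H.γ, H.served, H.datum, not_isMoverTrap_extJumpLocus_of_printSheafHandle H⟩
  · rintro ⟨γ, hγ, 𝓓, h⟩
    exact nonempty_printSheafHandle_of_untrapped hγ 𝓓 h

/-- **THE TYPED COUNTEREXAMPLE SHAPE (negation lens)**: NO handle at `(D, θ₀)` iff EVERY `AdmTw′`-pinned datum of EVERY pinned-served class has a
mover-trap Ext-jump locus. [cite: Markman2025SecantWeil, §9.3 Lemma 9.3.3] -/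
theorem isEmpty_printSheafHandle_iff_allTrapped :
    IsEmpty (D.PrintSheafHandle C θ₀) ↔
      ∀ γ ∈ secantQuotientServedClassesPinned D.Y.X (D.hY θ₀), ∀ 𝓓 : PinnedTwistedDatum C AdmTw' D.Y.X (D.hY θ₀) γ,
        IsMoverTrap D (extJumpLocus D.Y 𝓓.E) := by
  rw [← not_nonempty_iff, nonempty_printSheafHandle_iff_exists_untrapped]
  simp only [not_exists, not_and, not_not]

/-- `¬ PrintSheafHandleExists C` from ONE all-trapped non-hyperelliptic H-good polarised datum. [cite: Markman2025SecantWeil, §9.1 (Assumption 9.1.1)] -/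
theorem not_printSheafHandleExists_of_allTrapped (C : ChernCharacterBetti) (D : SecantQuotientDatum) (θ₀ : complexBetti D.𝒥.J.X 2)
    (hnh : ¬ D.𝒥.IsHyperelliptic) (hH : OrbitTranslatesDisjoint D.𝒥 D.G₁ D.G₂) (hθ₀ : D.𝒥.J.IsPolarizationClassOf D.Θ θ₀)
    (hall : ∀ γ ∈ secantQuotientServedClassesPinned D.Y.X (D.hY θ₀), ∀ 𝓓 : PinnedTwistedDatum C AdmTw' D.Y.X (D.hY θ₀) γ,
        IsMoverTrap D (extJumpLocus D.Y 𝓓.E)) :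
    ¬ PrintSheafHandleExists C := fun h =>
  (isEmpty_printSheafHandle_iff_allTrapped.2 hall).false (h D θ₀ hnh hH hθ₀).some

/-- Monotonicity of traps: a superset of a trap is a trap. [folklore] -/
theorem IsMoverTrap.mono
    {S S' : Set (D.Y.Points ℂ)} (h : IsMoverTrap D S) (hS : S ⊆ S') : IsMoverTrap D S' := fun T hT => by
  obtain ⟨m, g, x, hg, hcop, hx, hx1, hxS⟩ := h T hT
  exact ⟨m, g, x, hg, hcop, hx, hx1, hS hxS⟩

end Logic

/-! ## §2 Compositions (sorry-free; the line's stubs taken as hypotheses BY STATEMENT) -/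

/-- **NEGATIVE SIDE — the forced shape of a counterexample, carrier by carrier**: from (S1), a carrier whose Ext-jump locus contains `q(B(ℂ)) ∖ 1`
for a `φ_d`-stable abelian subvariety `B` of positive dimension underlies NO handle with that carrier (every bad set is defeated).
[cite: Markman2025SecantWeil, §9.3 Lemma 9.3.3] [cite: BirkenhakeLange2004, §13.4] -/
theorem isMoverTrap_extJumpLocus_of_psiStable_subset
    (hS1 : ∀ (D : SecantQuotientDatum) (B : AbelianVariety ℂ) (f : B ⟶ D.P),
      IsClosedImmersion (Hom.toSchemeHom f) → IsPsiStable D f → 0 < B.dim → IsMoverTrap D (qImageOff D f))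
    {D : SecantQuotientDatum} {B : AbelianVariety ℂ} (f : B ⟶ D.P) (hf : IsClosedImmersion (Hom.toSchemeHom f))
    (hψ : IsPsiStable D f) (hB : 0 < B.dim) (E : CochainComplex D.Y.X.left.Modules ℤ) (hE : qImageOff D f ⊆ extJumpLocus D.Y E) :
    IsMoverTrap D (extJumpLocus D.Y E) :=
  (hS1 D B f hf hψ hB).mono hE

/-- Hence: a handle whose carrier is Ext-entangled along a positive-dimensional `φ_d`-stable `B` does not exist. [cite: Markman2025SecantWeil, §9.3 Lemma 9.3.3] -/
theorem false_of_printSheafHandle_of_psiStable_subset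
    (hS1 : ∀ (D : SecantQuotientDatum) (B : AbelianVariety ℂ) (f : B ⟶ D.P),
      IsClosedImmersion (Hom.toSchemeHom f) → IsPsiStable D f → 0 < B.dim → IsMoverTrap D (qImageOff D f))
    {C : ChernCharacterBetti} {D : SecantQuotientDatum} {θ₀ : complexBetti D.𝒥.J.X 2} (H : D.PrintSheafHandle C θ₀)
    {B : AbelianVariety ℂ} (f : B ⟶ D.P) (hf : IsClosedImmersion (Hom.toSchemeHom f)) (hψ : IsPsiStable D f) (hB : 0 < B.dim)
    (hE : qImageOff D f ⊆ extJumpLocus D.Y H.datum.E) : False :=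
  not_isMoverTrap_extJumpLocus_of_printSheafHandle H (isMoverTrap_extJumpLocus_of_psiStable_subset hS1 f hf hψ hB H.datum.E hE)

/-- **POSITIVE SIDE — at K-simple data a proper-jump carrier IS a handle** (from (S2)). [cite: Raynaud1983SousVarietes, Théorème principal (p. 327)] -/
theorem nonempty_printSheafHandle_of_KSimple_of_properJump (hR : Raynaud1983_maninMumford)
    (hS2 : Raynaud1983_maninMumford → ∀ (D : SecantQuotientDatum), KSimple D →
      ∀ (V : SchemeOver ℂ) (ι : V ⟶ D.Y.X), IsClosedImmersion ι.left → Set.range (AlgPoints.map (L := ℂ) ι) ≠ Set.univ →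
        ∃ T : Finset ℕ, (∀ N ∈ T, 1 < N) ∧
          ∀ (m : ℤ) (g : D.Y ⟶ D.Y), D.IsMover m g → (∀ N ∈ T, ¬ ((N : ℤ) ∣ m ^ 2 + (D.d : ℤ))) →
            ∀ x : D.Y.Points ℂ, x ∈ Hom.kerPoints (specOver ℂ ℂ) g → x ≠ 1 → x ∉ Set.range (AlgPoints.map (L := ℂ) ι))
    {C : ChernCharacterBetti} {D : SecantQuotientDatum} {θ₀ : complexBetti D.𝒥.J.X 2} (hK : KSimple D)
    {γ : complexBetti D.Y.X (2 * 3)} (hγ : γ ∈ secantQuotientServedClassesPinned D.Y.X (D.hY θ₀))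
    (𝓓 : PinnedTwistedDatum C AdmTw' D.Y.X (D.hY θ₀) γ)
    (V : SchemeOver ℂ) (ι : V ⟶ D.Y.X) (hι : IsClosedImmersion ι.left) (hV : Set.range (AlgPoints.map (L := ℂ) ι) ≠ Set.univ)
    (hjump : extJumpLocus D.Y 𝓓.E ⊆ {1} ∪ Set.range (AlgPoints.map (L := ℂ) ι)) :
    Nonempty (D.PrintSheafHandle C θ₀) := by
  obtain ⟨T, hT, hconf⟩ := hS2 hR D hK V ι hι hV
  refine nonempty_printSheafHandle_of_untrapped hγ 𝓓 fun htrap => ?_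
  obtain ⟨m, g, x, hg, hcop, hx, hx1, hxS⟩ := htrap T hT
  rcases hjump hxS with h1 | hV'
  · exact hx1 h1
  · exact hconf m g hg hcop x hx hx1 hV'

/-- **(c4a) RE-KEYED, FROM THE STUBS**: `Raynaud1983_maninMumford → (S2) → (S3) → (S4) → ∀ C, PrintSheafHandleExistsEnd C`. Sorry-free composition;
the four displayed inputs are the line. [cite: Raynaud1983SousVarietes, Théorème principal (p. 327)] [cite: Markman2025SecantWeil, §9.3 Lemma 9.3.11] -/
theorem printSheafHandleExistsEnd_of_stubs (hR : Raynaud1983_maninMumford)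
    (hS2 : Raynaud1983_maninMumford → ∀ (D : SecantQuotientDatum), KSimple D →
      ∀ (V : SchemeOver ℂ) (ι : V ⟶ D.Y.X), IsClosedImmersion ι.left → Set.range (AlgPoints.map (L := ℂ) ι) ≠ Set.univ →
        ∃ T : Finset ℕ, (∀ N ∈ T, 1 < N) ∧
          ∀ (m : ℤ) (g : D.Y ⟶ D.Y), D.IsMover m g → (∀ N ∈ T, ¬ ((N : ℤ) ∣ m ^ 2 + (D.d : ℤ))) →
            ∀ x : D.Y.Points ℂ, x ∈ Hom.kerPoints (specOver ℂ ℂ) g → x ≠ 1 → x ∉ Set.range (AlgPoints.map (L := ℂ) ι))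
    (hS3 : ∀ (D : SecantQuotientDatum), EndTrivial D → KSimple D)
    (hS4 : ∀ (C : ChernCharacterBetti) (D : SecantQuotientDatum) (θ₀ : complexBetti D.𝒥.J.X 2),
      ¬ D.𝒥.IsHyperelliptic → OrbitTranslatesDisjoint D.𝒥 D.G₁ D.G₂ → D.𝒥.J.IsPolarizationClassOf D.Θ θ₀ → EndTrivial D →
      ∃ γ ∈ secantQuotientServedClassesPinned D.Y.X (D.hY θ₀), ∃ 𝓓 : PinnedTwistedDatum C AdmTw' D.Y.X (D.hY θ₀) γ,
        ∃ (V : SchemeOver ℂ) (ι : V ⟶ D.Y.X), IsClosedImmersion ι.left ∧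
          Set.range (AlgPoints.map (L := ℂ) ι) ≠ Set.univ ∧
          extJumpLocus D.Y 𝓓.E ⊆ {1} ∪ Set.range (AlgPoints.map (L := ℂ) ι)) :
    ∀ C : ChernCharacterBetti, PrintSheafHandleExistsEnd C := by
  intro C D θ₀ hnh hH hθ₀ hEnd
  obtain ⟨γ, hγ, 𝓓, V, ι, hι, hV, hjump⟩ := hS4 C D θ₀ hnh hH hθ₀ hEnd
  exact nonempty_printSheafHandle_of_KSimple_of_properJump hR hS2 (hS3 D hEnd) hγ 𝓓 V ι hι hV hjump


/-- **(c4) AT END-TRIVIAL DATA from the re-keyed node** — p646528's CRT engine verbatim with `hEnd` threaded: the statement birth.lean's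
`secondCarried_63_…_of_hGoodEndNodes` actually instantiates (it holds `hEnd` when it calls (c4)). [cite: Markman2025SecantWeil, §9.3 Lemma 9.3.3] -/
theorem offDiagonalExtVanishing_someMover_End_of_printSheafHandleExistsEnd (C : ChernCharacterBetti) (h : PrintSheafHandleExistsEnd C) :
    ∀ (D : SecantQuotientDatum) (θ₀ : complexBetti D.𝒥.J.X 2),
      ¬ D.𝒥.IsHyperelliptic → OrbitTranslatesDisjoint D.𝒥 D.G₁ D.G₂ → D.𝒥.J.IsPolarizationClassOf D.Θ θ₀ → EndTrivial D →
      ∀ (γ₁ : complexBetti D.Y.X (2 * 3)) (𝓓 : PinnedTwistedDatum C AdmTw' D.Y.X (D.hY θ₀) γ₁),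
        γ₁ ∈ secantQuotientServedClassesPinned D.Y.X (D.hY θ₀) →
        ∃ γ₀ ∈ secantQuotientServedClassesPinned D.Y.X (D.hY θ₀),
          ∃ (𝓓₀ : PinnedTwistedDatum C AdmTw' D.Y.X (D.hY θ₀) γ₀) (m : ℤ) (g : D.Y ⟶ D.Y),
            D.IsMover m g ∧ m ≠ 0 ∧ 3 * m ^ 2 ≠ (D.d : ℤ) ∧ m ^ 2 ≠ 3 * (D.d : ℤ) ∧ OffDiagonalExtVanishing D.Y g 𝓓₀.E := by
  intro D θ₀ hnh hH hθ₀ hEnd _ _ _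
  obtain ⟨H⟩ := h D θ₀ hnh hH hθ₀ hEnd
  obtain ⟨n, hn, hbad⟩ := exists_ge_forall_not_dvd_sq_add H.bad H.one_lt_of_mem_bad D.d (3 * D.d + 1)
  obtain ⟨g, hg⟩ := D.hasMover (n : ℤ)
  have hsq : n ≤ n ^ 2 := Nat.le_self_pow two_ne_zero n
  refine ⟨H.γ, H.served, H.datum, (n : ℤ), g, hg, ?_, ?_, ?_, H.offDiag (n : ℤ) g hg fun N hN hdvd => hbad N hN ?_⟩
  · have h0 : n ≠ 0 := by omega
    exact_mod_cast h0
  · have h1 : 3 * n ^ 2 ≠ D.d := ne_of_gt (by linarith)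
    exact_mod_cast h1
  · have h1 : n ^ 2 ≠ 3 * D.d := ne_of_gt (by linarith)
    exact_mod_cast h1
  · exact_mod_cast hdvd

/-! ## §3 Birth v3.14's 2m″ kernel composition with `hEnd` threaded into the (C^∨)-node (hypothesis form over tree theorems only) -/

/-- **2m″'s kernel composition with `hEnd` THREADED INTO (c4)** — birth.lean v3.14's `secondCarried_63_secantQuotientPinnedOffHypDisjEndPrime_of_hGoodEndNodes`
(l.453ff) transcribed byte-for-byte except that the (C^∨)-node hypothesis now carries the End-triviality of the presenting Jacobian and is invoked as
`hCvE D θ₀ hnh hH hθ₀ hEnd _ 𝓓 hqγ` (birth: `hCv D θ₀ hnh hH hθ₀ _ 𝓓 hqγ`, `hEnd` in scope and unused). Hypothesis form; kernel-checked.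
[cite: Markman2025SecantWeil, Thm. 1.4.1 (item 4), §1.5 (p. 7), §9.1 (p. 57) and §9.3 Lemma 9.3.11] [cite: Bloch1972Semiregularity, Remark (7.5)] -/
theorem secondCarried_63_offHypDisjEnd_of_hGoodEndNodesEnd (C : ChernCharacterBetti)
    (hsigH : ∀ (D : SecantQuotientDatum) (θ₀ : complexBetti D.𝒥.J.X 2),
      ¬ D.𝒥.IsHyperelliptic → OrbitTranslatesDisjoint D.𝒥 D.G₁ D.G₂ → D.𝒥.J.IsPolarizationClassOf D.Θ θ₀ →
      (∀ f : D.𝒥.J ⟶ D.𝒥.J, ∃ n : ℤ, f = n • 𝟙 D.𝒥.J) →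
      ∀ (m : ℤ) (g : D.Y ⟶ D.Y), D.IsMover m g → m ≠ 0 → 3 * m ^ 2 ≠ (D.d : ℤ) → m ^ 2 ≠ 3 * (D.d : ℤ) →
        ∀ (γ₁ : complexBetti D.Y.X (2 * 3)) (𝓓 : PinnedTwistedDatum C AdmTw' D.Y.X (D.hY θ₀) γ₁),
          γ₁ ∈ secantQuotientServedClassesPinned D.Y.X (D.hY θ₀) → OffDiagonalExtVanishing D.Y g 𝓓.E →
          ∃ γ₂ ∈ secantQuotientServedClassesPinned D.Y.X (D.hY θ₀),
            γ₂ ∈ carriedClasses (twistedReflexiveClass C AdmTw') 6 3 D.Y.X (D.hY θ₀) ∧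
            ∀ γ ∈ secantQuotientServedClassesPinned D.Y.X (D.hY θ₀), ∃ x y z : ℂ, γ = x • γ₁ + y • γ₂ + z • cupPowTwo (D.hY θ₀) 3)
    (hCvE : ∀ (D : SecantQuotientDatum) (θ₀ : complexBetti D.𝒥.J.X 2),
      ¬ D.𝒥.IsHyperelliptic → OrbitTranslatesDisjoint D.𝒥 D.G₁ D.G₂ → D.𝒥.J.IsPolarizationClassOf D.Θ θ₀ → EndTrivial D →
      ∀ (γ₁ : complexBetti D.Y.X (2 * 3)) (𝓓 : PinnedTwistedDatum C AdmTw' D.Y.X (D.hY θ₀) γ₁),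
        γ₁ ∈ secantQuotientServedClassesPinned D.Y.X (D.hY θ₀) →
        ∃ γ₀ ∈ secantQuotientServedClassesPinned D.Y.X (D.hY θ₀),
          ∃ (𝓓₀ : PinnedTwistedDatum C AdmTw' D.Y.X (D.hY θ₀) γ₀) (m : ℤ) (g : D.Y ⟶ D.Y),
            D.IsMover m g ∧ m ≠ 0 ∧ 3 * m ^ 2 ≠ (D.d : ℤ) ∧ m ^ 2 ≠ 3 * (D.d : ℤ) ∧ OffDiagonalExtVanishing D.Y g 𝓓₀.E) :
    ∀ (Y : SchemeOver ℂ) (θ : complexBetti Y 2), secantQuotientAnchorsPinned Y θ →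
      (∃ (D : SecantQuotientDatum) (e : Y ≅ D.Y.X) (θ₀ : complexBetti D.𝒥.J.X 2),
        ¬ D.𝒥.IsHyperelliptic ∧ OrbitTranslatesDisjoint D.𝒥 D.G₁ D.G₂ ∧ D.𝒥.J.IsPolarizationClassOf D.Θ θ₀ ∧
              (∀ f : D.𝒥.J ⟶ D.𝒥.J, ∃ n : ℤ, f = n • 𝟙 D.𝒥.J) ∧ complexBetti.map e.inv 2 θ = D.hY θ₀) →
      ∀ γ₁ ∈ secantQuotientServedClassesPinned Y θ,
        γ₁ ∈ carriedClasses (twistedReflexiveClass C AdmTw') 6 3 Y θ →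
        ∃ γ₂ ∈ secantQuotientServedClassesPinned Y θ,
          γ₂ ∈ carriedClasses (twistedReflexiveClass C AdmTw') 6 3 Y θ ∧
          ∀ γ ∈ secantQuotientServedClassesPinned Y θ, ∃ x y z : ℂ, γ = x • γ₁ + y • γ₂ + z • cupPowTwo θ 3 := by
  intro Y θ _ hpres γ₁ hγ₁ hc₁
  obtain ⟨D, e, θ₀, hnh, hH, hθ₀, hEnd, hpin⟩ := hpres
  -- the chart: `θ = e^* h_Y(θ₀)`
  have hθ : θ = complexBetti.map e.hom 2 (D.hY θ₀) := by rw [← hpin, e.complexBetti_map_hom_map_inv]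
  -- every pinned-served class of `(Y, θ)` moves to the datum's own chart
  have hmove : ∀ γ ∈ secantQuotientServedClassesPinned Y θ,
      complexBetti.map e.inv (2 * 3) γ ∈ secantQuotientServedClassesPinned D.Y.X (D.hY θ₀) := fun γ hγ => by
    have h := IsSecantQuotientWeilClassAtPinned.of_iso e.symm hγ
    rwa [Iso.symm_hom, hpin] at h
  have hγ₁' := hmove γ₁ hγ₁
  have hc₁' : complexBetti.map e.inv (2 * 3) γ₁ ∈ carriedClasses (twistedReflexiveClass C AdmTw') 6 3 D.Y.X (D.hY θ₀) := by
    have h := carriedClasses_map_of_respectsIso (twistedDoorPrime_respectsIso C) e.symm hc₁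
    rwa [Iso.symm_hom, hpin] at h
  -- a rational multiple of `γ₁'` is pinned-served and pinned by an `AdmTw′`-datum
  obtain ⟨q, hq, hqγ, ⟨𝓓⟩⟩ := exists_ratSmul_pinnedTwistedDatum_of_mem_carriedClasses hγ₁' hc₁'
  -- (c4) AT THE END-TRIVIAL DATUM (`hEnd` threaded — the only change): some carrier with some admissible mover satisfying (C^∨); then the signature
  obtain ⟨γ₀, hγ₀, 𝓓₀, m, g, hg, hm0, hm1, hm2, hCg⟩ := hCvE D θ₀ hnh hH hθ₀ hEnd _ 𝓓 hqγ
  obtain ⟨γ₂', hγ₂', hc₂', hspan'⟩ := hsigH D θ₀ hnh hH hθ₀ hEnd m g hg hm0 hm1 hm2 γ₀ 𝓓₀ hγ₀ hCg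
  -- exchange, pairing `γ₁'` with `γ₂'` or with `γ₀`
  obtain ⟨γ', hγ', hspan⟩ := exists_exchange_of_span_three hspan' hγ₁' (IsSecantQuotientWeilClassAtPinned.not_mem_span hγ₁')
  have hγ'S : γ' ∈ secantQuotientServedClassesPinned D.Y.X (D.hY θ₀) := by
    rcases hγ' with rfl | rfl
    · exact hγ₂'
    · exact hγ₀
  have hγ'c : γ' ∈ carriedClasses (twistedReflexiveClass C AdmTw') 6 3 D.Y.X (D.hY θ₀) := by
    rcases hγ' with rfl | rfl
    · exact hc₂'
    · exact 𝓓₀.mem_carriedClasses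
  -- transport back along `e`
  refine ⟨complexBetti.map e.hom (2 * 3) γ', ?_, ?_, fun γ hγ => ?_⟩
  · rw [hθ]; exact IsSecantQuotientWeilClassAtPinned.of_iso e hγ'S
  · rw [hθ]; exact carriedClasses_map_of_respectsIso (twistedDoorPrime_respectsIso C) e hγ'c
  · obtain ⟨x, y, z, hxyz⟩ := hspan _ (hmove γ hγ)
    refine ⟨x, y, z, ?_⟩
    have key := congrArg (fun w => complexBetti.map e.hom (2 * 3) w) hxyz
    simp only [map_add, map_smul, e.complexBetti_map_hom_map_inv] at key
    rw [key, map_cupPowTwo, ← hθ]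

end MoverTrap

end Summit.HodgeConjecture.HodgeConjecture.Ring2.SemiregularRepresentatives

end
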